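import Mathlib
import Summits.Ventures.PercRepro2.SwOutSevReal
import Summits.Ventures.PercRepro2.SwOutSevCore

/-!
# The constancy of the data along the core points of a block (blind cell PercRepro2, night-4 g22,
2026-08-27; proofs/NIGHT4-G22.md §3)

For a core-kind `Q`-point `ζ` with data `d = mixedDataR ζ` and base `b = coreBaseOf ζ`, and a CORE
point `q` of the raw cube of `d`, the realisation `ζ' = mixedRealR b q` has the extended hull of
`ζ` (`extHull_realR_core`), the canonical base `b` (`coreBaseOf_realR_core`), hence THE SAME DATA
(`mixedDataR_realR_core`, through `mixedDataR_congr`: the data depend on the configuration only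
through its extended hull and its canonical base); it is of the core kind (`coreKind_realR_core`)
and lies in the outside class (`realR_core_mem_outClass`).  These are the constancy facts the
partition needs along the core points of a block.
-/

namespace Summit.Ventures.PercRepro2

namespace MixedArms

open Hull LocRows BigBlock

variable {V : Type*} {E : Type*} [Fintype E] [DecidableEq E]

open scoped Classical

variable {ends : E → Sym2 V} {ρ : Type*} [Fintype ρ] {U : Set V} {ξ : Config E} {l h o u : V}
  {p : ρ → V}

section Congr

variable {ζ ζ' : Config E} (hH : extHull ends ζ' h u = extHull ends ζ h u)
  (hcb : coreBaseOf ends ζ' h u = coreBaseOf ends ζ h u)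
include hH hcb

omit [DecidableEq E] in
/-- **The data depend on the configuration only through its extended hull and its canonical
base.** -/
theorem mixedDataR_congr : mixedDataR ends h u p ζ' = mixedDataR ends h u p ζ := by
  have hA : ∀ r, AhOfR ends h u p ζ' r = AhOfR ends h u p ζ r := by
    intro r; simp only [AhOfR, armC_eq_of_extHull_eq hH]
  have hD : ∀ r, DeadBlueR ends h u p ζ' r ↔ DeadBlueR ends h u p ζ r := by
    intro r; simp only [DeadBlueR, hA, hcb]
  have hM : mixedR ends h u p ζ' = mixedR ends h u p ζ := by
    ext r; simp only [mem_mixedR_iff, hD]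
  have hPc : ∀ r y, pieceC ends h u p ζ' r y = pieceC ends h u p ζ r y := by
    intro r y; simp only [pieceC, hA]
  have hDE : ∀ r, deadEdgesR ends h u p ζ' r = deadEdgesR ends h u p ζ r := by
    intro r; ext e; simp only [mem_deadEdgesR_iff, hA]
  have hPE : ∀ r e, pieceOfEdgeR ends h u p ζ' r e = pieceOfEdgeR ends h u p ζ r e := by
    intro r e; ext v; simp only [pieceOfEdgeR, Set.mem_setOf_eq, hA, hPc]
  have hP : piecesR ends h u p ζ' = piecesR ends h u p ζ := by
    simp only [piecesR, hM]
    refine Finset.biUnion_congr rfl fun r _ => ?_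
    rw [hDE r]
    refine Finset.image_congr fun e _ => ?_
    rw [hPE r e]
  have hAb : absArmsR ends h u p ζ' = absArmsR ends h u p ζ := by
    ext x; simp only [mem_absArmsR_iff, hD, armC_eq_of_extHull_eq hH]
  have hU : uArmsR ends h u p ζ' = uArmsR ends h u p ζ := by
    ext P; simp only [mem_uArmsR_iff, armsC_eq_of_extHull_eq hH, armC_eq_of_extHull_eq hH]
  have hF : farArmsR ends h u p ζ' = farArmsR ends h u p ζ := by
    ext P; simp only [mem_farArmsR_iff, armsC_eq_of_extHull_eq hH, armC_eq_of_extHull_eq hH]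
  simp only [mixedDataR, hcb, hU, hM, hP, hAb, hF]

end Congr

section Core

variable (hj : MixedJunctionR ends U h u p o) (hl : l ∉ U) {ζ : Config E}
  (hζ : ζ ∈ swOutSide ends l h o U ξ) (hk : CoreKind ends U h u ζ)
include hj hl hζ hk

/-- The extended hull of `ζ` is the whole structure of its data. -/
theorem extHull_eq_structure :
    extHull ends ζ h u = {h} ∪ {u} ∪ Set.range ((mixedDataR ends h u p ζ).drop p) ∪
      armsAllR (mixedDataR ends h u p ζ).U (mixedDataR ends h u p ζ).Ah
        (mixedDataR ends h u p ζ).F := by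
  haveI := nonempty_ι_of_coreKind hj hl hζ hk
  have hb := mixedBaseR_of_coreKindR hj hl hζ hk
  have hup : ∀ r : (mixedDataR ends h u p ζ).ρ', ∃ e, ends e = s(u, (mixedDataR ends h u p ζ).drop p r) :=
    fun r => hj.hup r.1
  conv_lhs => rw [← mixedRealR_coreBaseOf_R hj hl hζ hk]
  exact hb.extHull_mixedRealR_core hup (core_qOfR ζ)

variable {q : PtR (mixedDataR ends h u p ζ).ι (mixedDataR ends h u p ζ).ρ'
  (mixedDataR ends h u p ζ).ν (mixedDataR ends h u p ζ).κ} (hq : Core q (mixedDataR ends h u p ζ).arm)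
include hq

/-- The extended hull of the realisation of a core point is that of `ζ`. -/
theorem extHull_realR_core :
    extHull ends (mixedRealR ends u (mixedDataR ends h u p ζ).U ((mixedDataR ends h u p ζ).drop p)
      (mixedDataR ends h u p ζ).Ah (mixedDataR ends h u p ζ).F (coreBaseOf ends ζ h u) q) h u =
      extHull ends ζ h u := by
  haveI := nonempty_ι_of_coreKind hj hl hζ hk
  have hb := mixedBaseR_of_coreKindR hj hl hζ hk
  have hup : ∀ r : (mixedDataR ends h u p ζ).ρ', ∃ e, ends e = s(u, (mixedDataR ends h u p ζ).drop p r) :=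
    fun r => hj.hup r.1
  rw [hb.extHull_mixedRealR_core hup hq, extHull_eq_structure hj hl hζ hk]

/-- The canonical base of the realisation of a core point is the base. -/
theorem coreBaseOf_realR_core :
    coreBaseOf ends (mixedRealR ends u (mixedDataR ends h u p ζ).U ((mixedDataR ends h u p ζ).drop p)
      (mixedDataR ends h u p ζ).Ah (mixedDataR ends h u p ζ).F (coreBaseOf ends ζ h u) q) h u =
      coreBaseOf ends ζ h u := by
  have hb := mixedBaseR_of_coreKindR hj hl hζ hk
  have hup : ∀ r : (mixedDataR ends h u p ζ).ρ', ∃ e, ends e = s(u, (mixedDataR ends h u p ζ).drop p r) :=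
    fun r => hj.hup r.1
  exact hb.coreBaseOf_mixedRealR_core hup hq

/-- **The data of the realisation of a core point are the data of `ζ`.** -/
theorem mixedDataR_realR_core :
    mixedDataR ends h u p (mixedRealR ends u (mixedDataR ends h u p ζ).U
      ((mixedDataR ends h u p ζ).drop p) (mixedDataR ends h u p ζ).Ah (mixedDataR ends h u p ζ).F
      (coreBaseOf ends ζ h u) q) = mixedDataR ends h u p ζ :=
  mixedDataR_congr (extHull_realR_core hj hl hζ hk hq) (coreBaseOf_realR_core hj hl hζ hk hq)

/-- **The realisation of a core point is of the core kind.** -/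
theorem coreKind_realR_core :
    CoreKind ends U h u (mixedRealR ends u (mixedDataR ends h u p ζ).U
      ((mixedDataR ends h u p ζ).drop p) (mixedDataR ends h u p ζ).Ah (mixedDataR ends h u p ζ).F
      (coreBaseOf ends ζ h u) q) := by
  haveI := nonempty_ι_of_coreKind hj hl hζ hk
  have hb := mixedBaseR_of_coreKindR hj hl hζ hk
  have hup : ∀ r : (mixedDataR ends h u p ζ).ρ', ∃ e, ends e = s(u, (mixedDataR ends h u p ζ).drop p r) :=
    fun r => hj.hup r.1
  have hHU : extHull ends ζ h u ⊆ U := extHull_subset_of_coreKind hζ hk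
  refine ⟨?_, fun x hx => hHU (by rw [← extHull_realR_core hj hl hζ hk hq]; exact Or.inr hx)⟩
  obtain ⟨j⟩ := ‹Nonempty (mixedDataR ends h u p ζ).ι›
  cases hj' : q.1 j with
  | true =>
    left
    rw [hb.cluster_mixedRealR hup (not_leakRR_of_core hq), mem_redSetR_iff]
    exact Or.inr (Or.inr (Or.inl ⟨rfl, j, hj'⟩))
  | false =>
    right
    rw [hb.cluster_blue_mixedRealR hup (not_leakBR_of_core hq), mem_redSetR_iff]
    exact Or.inr (Or.inr (Or.inl ⟨rfl, j, by rw [flipPt_fst, hj']; rfl⟩))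

omit hl hq in
/-- An edge of a flipped class touches the structure. -/
lemma mem_touches_U_of_mem_flipSetR {q' : PtR (mixedDataR ends h u p ζ).ι
    (mixedDataR ends h u p ζ).ρ' (mixedDataR ends h u p ζ).ν (mixedDataR ends h u p ζ).κ} {e : E}
    (he : e ∈ flipSetR ends u (mixedDataR ends h u p ζ).U ((mixedDataR ends h u p ζ).drop p)
      (mixedDataR ends h u p ζ).Ah (mixedDataR ends h u p ζ).F q') : e ∈ touches ends U := by
  have hHU : extHull ends ζ h u ⊆ U := extHull_subset_of_coreKind hζ hk
  have huU : u ∈ U := hk.2 (Or.inl (mem_cluster_self _ _ _))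
  rcases he with (((⟨j, -, x, hx, y, hxy⟩ | ⟨i, -, x, hx, y, hxy⟩) | ⟨r, -, hup⟩) |
    ⟨r, -, z, hpz, -, -⟩) | ⟨k, -, x, hx, y, hxy⟩
  · exact ⟨x, hHU (mem_extHull_of_mem_armsAllR hj (Or.inl (Or.inl (Set.mem_iUnion.2 ⟨j, hx⟩)))).1,
      y, hxy⟩
  · exact ⟨x, hHU (mem_extHull_of_mem_armsAllR hj (Or.inl (Or.inr (Set.mem_iUnion.2 ⟨i, hx⟩)))).1,
      y, hxy⟩
  · exact ⟨u, huU, _, hup⟩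
  · exact ⟨_, hHU (p_mem_extHull (hj.hup r.1) ζ), z, hpz⟩
  · exact ⟨x, hHU (mem_extHull_of_mem_armsAllR hj (Or.inr (Set.mem_iUnion.2 ⟨k, hx⟩))).1, y, hxy⟩

omit [Fintype ρ] hj hl hq in
/-- The canonical base agrees with `ζ` off the edges touching `U`. -/
lemma coreBaseOf_agree_R {e : E} (he : e ∉ touches ends U) :
    coreBaseOf ends ζ h u e = ζ e := by
  apply flip_apply_of_notMem
  rintro ⟨x, hx, y, hxy⟩
  exact he ⟨x, extHull_subset_of_coreKind hζ hk (blueExt_subset_extHull hx), y, hxy⟩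

/-- **The realisation of a core point lies in the outside class.** -/
theorem realR_core_mem_outClass :
    mixedRealR ends u (mixedDataR ends h u p ζ).U ((mixedDataR ends h u p ζ).drop p)
      (mixedDataR ends h u p ζ).Ah (mixedDataR ends h u p ζ).F (coreBaseOf ends ζ h u) q ∈
      outClass ends U h ξ := by
  have hb := mixedBaseR_of_coreKindR hj hl hζ hk
  have hup : ∀ r : (mixedDataR ends h u p ζ).ρ', ∃ e, ends e = s(u, (mixedDataR ends h u p ζ).drop p r) :=
    fun r => hj.hup r.1
  have hHU : extHull ends ζ h u ⊆ U := extHull_subset_of_coreKind hζ hk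
  rw [mem_outClass]
  refine ⟨fun e he => ?_, fun x hx => ?_⟩
  · have hne : e ∉ flipSetR ends u (mixedDataR ends h u p ζ).U ((mixedDataR ends h u p ζ).drop p)
        (mixedDataR ends h u p ζ).Ah (mixedDataR ends h u p ζ).F q :=
      fun h' => he (mem_touches_U_of_mem_flipSetR hj hζ hk h')
    unfold mixedRealR
    rw [if_neg hne, coreBaseOf_agree_R hζ hk he]
    exact (mem_outClass.1 (mem_swOutSide.1 hζ).2).1 e he
  · have hx' := hb.hull_mixedRealR_subset hup (not_leakRR_of_core hq) (not_leakBR_of_core hq) hx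
    rw [← extHull_eq_structure hj hl hζ hk] at hx'
    exact hHU hx'

end Core

end MixedArms

end Summit.Ventures.PercRepro2
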